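import Mathlib
import HarnessLib
import Summits.CriticalPhenomena.SAWScalingLimit.Theses.SAWDefectDecoherence

/-!
# Sketch — crux-ideate stmt-CriticalPhenomena-8549 (DefectDecoherence), ideator 1, round 1

First lemmas of the two idea cards (they need not be proved here; they must elaborate):

* `FirstStepDecomposition` — card `tip-martingale-depth-induction`: the generator of the exact
  exploration martingale (first-step decomposition of the DCS observable under moving the root
  one step into the domain; windings add because the new root's half-edge has the direction of
  the first step).
* `StarSpinShift` — card `winding-zero-sector`: the conjugate star defect of the crux IS the plain
  star sum of the spin `σ - 2 = -11/8` observable, in norm, with the factor `ℓ/2 = 1/(2√3)`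
  (cube identity `(c_t - c_v)³ = const` over the three neighbours + the route's SpinShift).
* `RealRootedFourierBound` — card `winding-zero-sector`: Pólya-frequency (real-rooted) mass
  sequences are maximally incoherent: `|Σ p_k e^{-ikω}| ≤ (Σ p_k)·exp(-(1 - cos ω)·Var)`.
-/

namespace Summit.CriticalPhenomena.SAWScalingLimit.Cruxes.DefectDecoherence.Sketch

open scoped BigOperators
open Literature.Probability.LatticeModels Literature.Probability.RandomPlanarGeometry.SAW

/-- Card A, first lemma (exact, finite; the one-step generator of the exploration martingale):
for a boundary root `a = {u, w}` (`u ∉ Λ ∋ w`) with the two other neighbours `p, q` of `w`,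
and any target mid-edge `z ≠ a`,
`F_{Λ,a}(z) = Σ_{w' ∈ {p,q}} x · e^{-iσ·turn(u→w→w')} · [z = {w,w'}] or F_{Λ∖w, {w,w'}}(z)`. -/
def FirstStepDecomposition : Prop :=
  ∀ (Λ : Finset HexVertex) (u w p q : HexVertex), hexGraph.Adj u w → u ∉ Λ → w ∈ Λ →
    hexGraph.Adj w p → hexGraph.Adj w q → p ≠ u → q ≠ u → p ≠ q →
    ∀ (x σ : ℝ) (z : Sym2 HexVertex), z ≠ s(u, w) →
      hexParafermionicObservable Λ s(u, w) x σ z =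
        ∑ w' ∈ ({p, q} : Finset HexVertex),
          (x : ℂ) * Complex.exp (-Complex.I * σ *
              (Polyline.turning (hexMidpoint s(u, w)) (hexCenter w) (hexMidpoint s(w, w')) : ℝ)) *
            (if z = s(w, w') then 1
             else hexParafermionicObservable (Λ.erase w) s(w, w') x σ z)

/-- Card B, first lemma (exact, every `x, σ, Λ`, no simple connectivity needed): the conjugate
star combination of the crux equals, in norm, `ℓ/2 = 1/(2√3)` times the plain star sum of the
spin-`(σ-2)` observable. With `σ = 5/8`: the defect is the star sum at spin `-11/8`. -/
def StarSpinShift : Prop :=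
  ∀ (Λ : Finset HexVertex) (u w : HexVertex), hexGraph.Adj u w → u ∉ Λ → w ∈ Λ →
    ∀ (v : HexVertex) (x σ : ℝ),
      ‖∑ t ∈ Λ.filter (fun t => hexGraph.Adj v t),
          (starRingEnd ℂ) (hexMidpoint s(v, t) - hexCenter v) *
            hexParafermionicObservable Λ s(u, w) x σ s(v, t)‖ =
        (1 / (2 * Real.sqrt 3)) *
          ‖∑ t ∈ Λ.filter (fun t => hexGraph.Adj v t),
              hexParafermionicObservable Λ s(u, w) x (σ - 2) s(v, t)‖

/-- Card B, analytic engine (pure Mathlib): a finitely supported nonnegative sequence whose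
generating polynomial splits over `ℝ` with nonpositive roots (a Pólya frequency sequence = law
of a sum of independent Bernoulli variables) has Fourier transform bounded by
`mass · exp(-(1 - cos ω) · variance)`. -/
def RealRootedFourierBound : Prop :=
  ∀ (p : ℕ → ℝ) (n : ℕ), (∀ k, 0 ≤ p k) → 0 < ∑ k ∈ Finset.range (n + 1), p k →
    Polynomial.Splits
        (∑ k ∈ Finset.range (n + 1), Polynomial.C (p k) * Polynomial.X ^ k : Polynomial ℝ) →
    (∀ r ∈ (∑ k ∈ Finset.range (n + 1), Polynomial.C (p k) * Polynomial.X ^ k).roots, r ≤ 0) →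
    ∀ ω : ℝ,
      ‖∑ k ∈ Finset.range (n + 1), (p k : ℂ) * Complex.exp (-Complex.I * (k : ℂ) * (ω : ℂ))‖ ≤
        (∑ k ∈ Finset.range (n + 1), p k) *
          Real.exp (-(1 - Real.cos ω) *
            ((∑ k ∈ Finset.range (n + 1), ((k : ℝ) -
                (∑ j ∈ Finset.range (n + 1), (j : ℝ) * p j) /
                  (∑ j ∈ Finset.range (n + 1), p j)) ^ 2 * p k) /
              (∑ k ∈ Finset.range (n + 1), p k)))

/-- The crux, restated through `StarSpinShift` (equivalent given that lemma): decoherence of the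
lifted final direction at frequency `11/8` against the mass, for `R`-deep vertices. This is only a
reading aid for the cards; the crux decl itself is the route's `DefectDecoherence`. -/
def DefectDecoherenceSpinForm : Prop :=
  ∃ C θ : ℝ, 3 / 4 < θ ∧ ∀ (Λ : Finset HexVertex), hexDomainSimplyConnected Λ →
    ∀ (u w : HexVertex), hexGraph.Adj u w → u ∉ Λ → w ∈ Λ →
    ∀ (v : HexVertex) (R : ℝ), 1 ≤ R →
      (∀ y : HexVertex, dist (hexCenter y) (hexCenter v) ≤ R → y ∈ Λ) →
      ‖∑ t ∈ Λ.filter (fun t => hexGraph.Adj v t),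
          hexParafermionicObservable Λ s(u, w) hexCriticalFugacity (5 / 8 - 2) s(v, t)‖ ≤
        C * R ^ (-θ) * ∑ t ∈ Λ.filter (fun t => hexGraph.Adj v t),
          ‖hexParafermionicObservable Λ s(u, w) hexCriticalFugacity 0 s(v, t)‖

/-- Sanity: the spin form implies the crux given `StarSpinShift` (pure algebra, constants
`C ↦ C/(2√3)`); stated, not proved here. -/
def SpinFormImpliesCrux : Prop :=
  StarSpinShift → DefectDecoherenceSpinForm →
    Summit.CriticalPhenomena.SAWScalingLimit.Theses.SAWDefectDecoherence.DefectDecoherence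

end Summit.CriticalPhenomena.SAWScalingLimit.Cruxes.DefectDecoherence.Sketch
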